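import Summits.QuantumFields.YangMills.Theorems.FluctuationComparisonRegPrIntLS2BetaChartReadBkgLetters
import HarnessLib

/-!
# S2β · (β-3)′ FILE C₂ — THE SECOND VARIATION OF THE CHART READ IS LIPSCHITZ IN THE BACKGROUND:
# `‖[ψ_{U₀}(X)c − Dψ_{U₀}(0)Xc] − [ψ_1(X)c − Dψ_1(0)Xc]‖ ≤ 8·(67ℓκ)·‖X‖²∕a²` when `‖U₀(b) − 1‖ ≤ κ` on the bonds issuing from `B(c₋) ∪ B(c₊)` (`100ℓκ ≤ ρ`);
# hence (β-3)′ AT A CURVED BACKGROUND: `‖ψ_{U₀}(X)c − Dψ_{U₀}(0)Xc‖ ≤ 8B·OSC²∕(a − ‖A‖)² + 32B·OSC·‖A‖∕a² + (ℓ‖A‖)³ + 8·(67ℓκ)·‖X‖²∕a²` (`OSC = ‖X − X̄‖`, `X̄ b = A b.dir`, `B = 54ℓ(e^a − 1)`)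

Cell `ym3-torus` (YM ladder rung R3 = continuum `SU(2)` Yang–Mills on the three-torus at fixed lattice data — a RUNG: NOT d = 4, NOT infinite volume, NOT a mass gap,
NOT Clay).  Width seat `ym3-torus-px13` (gen 28); crux `stmt-QuantumFields-20520`, LINE g18-1 S2β, pairing lane; (SCT″-c)₁ source budget (S-SRC) ∕ (β-3)′ (ARCHITECT RULING px17 g22
2026-08-31T19:55:50Z «(β-3)′ YES — px13's pen»: the order-2 chart remainder in OSCILLATION + BACKGROUND-CURVATURE form `q·M·OSC + q′·M²·κ(U₀) + q₃M³`, the cure of HAZARD «SRC-q (2)»).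
`--kind proof --supports stmt-QuantumFields-20520 --as helper`, count-neutral, DEFINITION-FREE (0 `def`, 0 `instance`, 0 `notation`, 0 `sorry`, default heartbeats); generic `P : Params`,
`SU(N)`, the N09 ∕ (D1) ∕ (β-1)–(β-4) chart-read conventions (the complexified objects written out as terms, as in (β-1)).

WHY (HAZARD «SRC-q (2)», px13 g27; UV3-NODE §107): an ADDITIVE order-2 chart remainder `q·M²` per level is a relative error per level and piles up `log_L N` on smooth small-amplitude relative
data; the cure is the order-2 brick in OSCILLATION + BACKGROUND-CURVATURE form.  ✓p833442 (FILE A) reduced it to CONST on (covariantly) constant fields; ✓p834334∕✓p834640 (B₁∕B₂) proved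
CONST at the FLAT background with a CUBIC remainder and no `q·M²` («the symmetric comb kills the second variation»).  THIS FILE supplies the curvature half: the second-order remainder
`F(U₀, X) := ψ_{U₀}(X)c − Dψ_{U₀}(0)Xc` moves by at most `q′·κ·‖X‖²` when the background moves from `1` to a `U₀` that is `κ`-close to `1` on the read region — for EVERY direction `X`
(not only constant ones), so FILE A's free reference field `X̄` and B₂'s flat oscillation bound transfer to the curved background verbatim.

THE ROAD (print's, [Balaban1985Averaging] Prop. 3 p.36 «analytic function of A» + Cauchy; Prop. 4 (148)–(149) «the remainder … is Lipschitz»).  By FILE C₁ the complexified relative averages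
`G^{U₀}_c(A) = eml(W^{U₀}_A(loops))·W^{U₀}_A([c₋,c₊])·Ū(U₀)(c)⋆` and `G^{1}_c(A)` differ by `≤ 24ℓκ(1+2τ) + (1+24τ)·2ℓκ + (1+24τ)(1+2τ)·26ℓκ ≤ 60ℓκ` on the polydisc (`τ = ℓ(e^{‖A‖} − 1) ≤ ρ∕100`,
three-term split; `eml` `12`-Lipschitz, lit ✓`norm_eml_add_sub_eml_le`); both are within `27τ ≤ 1∕10` of `1` ((β-1) ✓`norm_cplxRelAvg_sub_one_le`), where the series `log` is `10∕9`-Lipschitz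
(lit ✓`MatrixLogLipschitz.norm_mlog_sub_mlog_le`), so `h := Φ^{U₀}_c − Φ^{1}_c` is holomorphic on the sup-norm ball `‖A‖ < a` ((β-2) ✓`differentiableOn_cplxChartRead` ×2) with `‖h‖ ≤ 67ℓκ`
and `h(0) = 0`; Cauchy's second-order estimate along the complex line through `X̂` (lit ✓`B7TransferAnalyticMean.norm_sub_sub_fderiv_le_of_line`) bounds `h(X̂) − Dh(0)X̂` by `8·67ℓκ·‖X‖²∕a²`,
and the real slice ((β-2) ✓`coe_chartRead_eq_cplxChartRead`, ✓`coe_fderiv_chartRead_apply_eq`, at `U₀` and at `1`) reads it as the difference of the two second-order remainders.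

WHAT IS PROVED (sorry-free; `ℓ = (d+2)L`; hypotheses as in (β-3): `0 < ρ ≤ innerRadius (specialUnitaryLogChart (Fin N))`, loop guard `dist1 (loopHol U₀ c i) ≤ α` at every coarse bond,
`4α ≤ ρ`; plus the standing range `j + 1 ≤ m + K`, the LOCAL background letter `hκ : ∀ b, blockOf b.src ∈ {c₋, c₊} → ‖U₀(b) − 1‖ ≤ κ` and `100ℓκ ≤ ρ`).
* §5 polydisc: `coe_avgFun_one` (`↑Ū(1)(c) = 1`), `norm_loopTupleC_one_sub_one_le`, ★★`norm_cplxRelAvg_sub_cplxRelAvg_one_le` (**`‖G^{U₀}_c(A) − G^{1}_c(A)‖ ≤ 60·ℓ·κ`**),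
  ★★`norm_cplxChartRead_sub_cplxChartRead_one_le` (**`‖Φ^{U₀}_c(A) − Φ^{1}_c(A)‖ ≤ 67·ℓ·κ`**).
* §6 ★★★`norm_chartRead_remainder_sub_flat_le` (the title: radius `0 < a`, `100ℓ(e^a − 1) ≤ ρ`, `4‖X‖ ≤ a` ⟹ `≤ 8·(67ℓκ)·‖X‖²∕a²`);
  ★★★`norm_chartRead_sub_fderiv_le_curved_osc` = ✓p834640 `norm_chartRead_sub_fderiv_le_flat_osc` + the title: for `A : Fin d → 𝔰𝔲(N)`, `8‖A‖ ≤ a`, `8‖X − X̄‖ ≤ a`: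
  **`‖↑(ψ_{U₀}(X)c) − ↑((Dψ_{U₀}(0)X)c)‖ ≤ 8B‖X − X̄‖²∕(a − ‖A‖)² + 32B‖X − X̄‖‖A‖∕a² + (ℓ‖A‖)³ + 8·(67ℓκ)·‖X‖²∕a²`** — (β-3)′ at a background `κ`-close to `1` on the read region: NO `q·M²` term;
  the order-2 price is OSCILLATION × amplitude, amplitude² × BACKGROUND DEVIATION `κ`, and a CUBIC term.
WHAT THE CONSUMER STILL SUPPLIES (named, not here): the axial-gauge letter producing the gauge copy of the (α, δ)-small background with `κ = C(Lδ + α)` on `B(c₋) ∪ B(c₊)`, and the gauge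
covariance of `ψ_{U₀}(X)c` ∕ `Dψ_{U₀}(0)Xc` (so that «covariantly constant `X̄`» = the gauge image of `A ∘ dir`); the OSC-lift letter (px12 ✓FILE M) prices `‖X − X̄‖`.

HONEST.  Elementary telescoping ∕ Lipschitz bookkeeping over LANDED lit engines (`Node00.AveragingSmooth`, `BlockAveragingEMLAnalyticMean`, `MatrixLogLipschitz`, `B7TransferAnalyticMean`,
`T3DescentFibreTower`) and the (β-1)∕(β-2)∕(β-3) chart-read files; NO estimate of Bałaban's renormalisation analysis is asserted or proved ([Balaban1985Averaging] (19)–(21), Prop. 3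
(121)–(125), Prop. 4 (148)–(149) and [Balaban1987RG1] (0.3)–(0.4) are cited as the SOURCES of the objects and of the shape of the estimate); the axial-gauge letter «`PlaqSmall δ` + loop
guard `α` ⟹ a gauge copy of `U₀` with `‖U₀(b) − 1‖ ≤ C(Lδ + α)` on `B(c₋) ∪ B(c₊)`», the gauge covariance of `ψ`, the OSC-lift letter, (RSP-Σ), (BKG), rows v2, (ST‴), (SCT″-c)₁₂₃, LOC‴,
GAP♯∘ (`stub_uniformFibreGapOrbit`, registry 3732b7df UNTOUCHED, 0∕5), the five REGISTERED stubs, S2β, crux 20520, 19936, 19200, `YM3TorusSU2` — NOT proved; no summit statement is proved by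
a helper; rung R3 = SU(2) YM₃ on T³ at fixed lattice data — NOT d = 4, NOT infinite volume, NOT a mass gap, NOT Clay; the Yang–Mills mass gap is NOT proved.  Axioms standard.

References: [Balaban1985Averaging] T. Bałaban, CMP **98** (1985) 17–51, (15) p.19, (19)–(21) p.21, Prop. 3 (121)–(125) p.36, Prop. 4 (148)–(149) p.40; [Balaban1987RG1] CMP **109** (1987)
249–301, (0.3)–(0.4), (0.8) pp.252–253; [Balaban1985BackgroundPropagators] CMP **99** (1985) 389–434, (3.6) p.391.
-/

set_option autoImplicit false

noncomputable section

open scoped Matrix.Norms.L2Operator Topology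
open Filter Set Function Metric

namespace Summit.QuantumFields.YangMills.Theorems.FluctuationComparisonRegPrIntLS2BetaChartReadBkgLipschitz

open Literature.MathematicalPhysics.QuantumFieldTheory.Balaban1983to89
open Literature.MathematicalPhysics.QuantumFieldTheory.Balaban1983to89.HaarExponentialChart
open Literature.MathematicalPhysics.QuantumFieldTheory.Balaban1983to89.HaarExponentialChart.IsChartRep
open Literature.MathematicalPhysics.QuantumFieldTheory.Balaban1983to89.BlockAveraging (Small Idx avgFun loopHol off corr blockOf_src_of_mem_walk)
open Literature.MathematicalPhysics.QuantumFieldTheory.Balaban1983to89.ExpMeanLog (eml expMeanLogSU deltaSU deltaSU_pos)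
open Literature.MathematicalPhysics.QuantumFieldTheory.Balaban1983to89.Node00
open Literature.MathematicalPhysics.QuantumFieldTheory.Balaban1983to89.T4Continuum (walk holAt LStep loopWord)
open Literature.MathematicalPhysics.QuantumFieldTheory.Balaban1983to89.BlockAveragingEMLLinearised (length_walk length_walk_replicate_le)
open Literature.MathematicalPhysics.QuantumFieldTheory.Balaban1983to89.LatticeWordStokes (length_loopWord_le)
open Literature.MathematicalPhysics.QuantumFieldTheory.Balaban1983to89.BlockAveragingEMLAnalyticMean (eml_one norm_eml_add_sub_eml_le)
open MatrixLog (mlog mlog_one)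
open Summit.QuantumFields.YangMills.BalabanUVNodes.N09ChartReadAveragingSmooth
open Summit.QuantumFields.YangMills.BalabanUVNodes.N09CentralWindowInjective (norm_coe_SU_le_one)
open Summit.QuantumFields.YangMills.Theorems.FluctuationComparisonRegPrIntLS2BetaChartReadCplxExtension
open Summit.QuantumFields.YangMills.Theorems.FluctuationComparisonRegPrIntLS2BetaChartReadCplxAnalytic
open Summit.QuantumFields.BalabanUV.T4Continuum.Spine.NE7 (blockOf_src_of_mem_axWalk)
open Summit.QuantumFields.YangMills.Theorems.FluctuationComparisonRegPrIntLS2BetaChartReadBkgLetters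

/-! ## §5 On the polydisc: `‖G^{U₀}_c(A) − G^{1}_c(A)‖ ≤ 60ℓκ` and `‖Φ^{U₀}_c(A) − Φ^{1}_c(A)‖ ≤ 67ℓκ` -/

section Polydisc

variable {P : Params} {j : ℕ} {N : ℕ} [NeZero N] (U₀ : GaugeField P j (SU N))

/-- The flat background average is trivial: `↑Ū(1)(c) = 1` (lit `avgFun_one`, `expMeanLogSU_E_one`). [cite: Balaban1987RG1, (0.4) p.253 (bookkeeping)] -/
theorem coe_avgFun_one (c : PBond P (j + 1)) : ((avgFun (expMeanLogSU (n := Fin N)) (1 : GaugeField P j (SU N)) c : SU N) : Matrix (Fin N) (Fin N) ℂ) = 1 := by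
  rw [T3DescentFibreTower.avgFun_one _ T3DescentFibreTower.expMeanLogSU_E_one]; rfl

/-- The flat loop tuple IS `1` and so the complexified flat loop tuple is within `2ℓ(e^{‖A‖} − 1)` of `1`. [cite: Balaban1987RG1, (0.4) p.253 (bookkeeping)] -/
theorem norm_loopTupleC_one_sub_one_le (c : PBond P (j + 1)) (A : PBond P j → Matrix (Fin N) (Fin N) ℂ) {ρ : ℝ} (hρ3 : ρ ≤ 1 / 3)
    (hA : 100 * ((((P.d + 2) * P.L : ℕ) : ℝ) * (Real.exp ‖A‖ - 1)) ≤ ρ) :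
    ‖(fun i : Idx P => ((walk (emb c.src) (loopWord P.L c.dir (off i.1) i.2.1 i.2.2)).map (fun s : LStep P j => if s.fwd then NormedSpace.exp (A s.bond) * (((1 : GaugeField P j (SU N)) s.bond : SU N) : Matrix (Fin N) (Fin N) ℂ) else star (((1 : GaugeField P j (SU N)) s.bond : SU N) : Matrix (Fin N) (Fin N) ℂ) * NormedSpace.exp (-(A s.bond)))).prod) - 1‖ ≤ 2 * ((((P.d + 2) * P.L : ℕ) : ℝ) * (Real.exp ‖A‖ - 1)) := by
  have h0 : ‖(fun i : Idx P => loopM (coeField (1 : GaugeField P j (SU N))) c i) - 1‖ ≤ 0 :=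
    norm_loopM_tuple_sub_one_le (1 : GaugeField P j (SU N)) c (α := 0) fun i => by rw [T3DescentFibreTower.loopHol_one, GaugeGroup.dist1_one]
  have h1 : (fun i : Idx P => loopM (coeField (1 : GaugeField P j (SU N))) c i) = 1 := by rwa [norm_le_zero_iff, sub_eq_zero] at h0
  have h := norm_loopTupleC_sub_le (1 : GaugeField P j (SU N)) c A
  rw [h1] at h
  exact h.trans (exp_pow_sub_one_le (norm_nonneg A) le_rfl (by linarith))

/-- ★★ **THE COMPLEXIFIED RELATIVE AVERAGES AT `U₀` AND AT `1` DIFFER BY `60ℓκ` ON THE POLYDISC**: for `100ℓ(e^{‖A‖} − 1) ≤ ρ ≤` inner radius, `100ℓκ ≤ ρ` and `‖U₀(b) − 1‖ ≤ κ` on the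
bonds issuing from `B(c₋) ∪ B(c₊)`: `‖G^{U₀}_c(A) − G^{1}_c(A)‖ ≤ 60·ℓ·κ` (three-term split: `eml` `12`-Lipschitz × loop tuples `2ℓκ` apart; segments `2ℓκ` apart; `Ū(U₀)(c)` within `26ℓκ` of `Ū(1)(c) = 1`).
[cite: Balaban1987RG1, (0.4), (0.8) p.253; Balaban1985Averaging, (19)-(21) p.21, Prop. 3 p.36] -/
theorem norm_cplxRelAvg_sub_cplxRelAvg_one_le (hj : j + 1 ≤ P.m + P.K) (c : PBond P (j + 1)) {ρ κ : ℝ} (hρ : ρ ≤ innerRadius (specialUnitaryLogChart (Fin N)))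
    (hκℓ : 100 * ((((P.d + 2) * P.L : ℕ) : ℝ) * κ) ≤ ρ)
    (hκ : ∀ b : PBond P j, (blockOf b.src = c.src ∨ blockOf b.src = c.tgt) → ‖((U₀ b : SU N) : Matrix (Fin N) (Fin N) ℂ) - 1‖ ≤ κ)
    (A : PBond P j → Matrix (Fin N) (Fin N) ℂ) (hA : 100 * ((((P.d + 2) * P.L : ℕ) : ℝ) * (Real.exp ‖A‖ - 1)) ≤ ρ) :
    ‖eml (fun i : Idx P => ((walk (emb c.src) (loopWord P.L c.dir (off i.1) i.2.1 i.2.2)).map (fun s : LStep P j => if s.fwd then NormedSpace.exp (A s.bond) * ((U₀ s.bond : SU N) : Matrix (Fin N) (Fin N) ℂ) else star ((U₀ s.bond : SU N) : Matrix (Fin N) (Fin N) ℂ) * NormedSpace.exp (-(A s.bond)))).prod) * ((walk (emb c.src) (List.replicate P.L (c.dir, true))).map (fun s : LStep P j => if s.fwd then NormedSpace.exp (A s.bond) * ((U₀ s.bond : SU N) : Matrix (Fin N) (Fin N) ℂ) else star ((U₀ s.bond : SU N) : Matrix (Fin N) (Fin N) ℂ) * NormedSpace.exp (-(A s.bond)))).prod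 * star ((avgFun (expMeanLogSU (n := Fin N)) U₀ c : SU N) : Matrix (Fin N) (Fin N) ℂ) -
      (eml (fun i : Idx P => ((walk (emb c.src) (loopWord P.L c.dir (off i.1) i.2.1 i.2.2)).map (fun s : LStep P j => if s.fwd then NormedSpace.exp (A s.bond) * (((1 : GaugeField P j (SU N)) s.bond : SU N) : Matrix (Fin N) (Fin N) ℂ) else star (((1 : GaugeField P j (SU N)) s.bond : SU N) : Matrix (Fin N) (Fin N) ℂ) * NormedSpace.exp (-(A s.bond)))).prod) * ((walk (emb c.src) (List.replicate P.L (c.dir, true))).map (fun s : LStep P j => if s.fwd then NormedSpace.exp (A s.bond) * (((1 : GaugeField P j (SU N)) s.bond : SU N) : Matrix (Fin N) (Fin N) ℂ) else star (((1 : GaugeField P j (SU N)) s.bond : SU N) : Matrix (Fin N) (Fin N) ℂ) * NormedSpace.exp (-(A s.bond)))).prod * star ((avgFun (expMeanLogSU (n := Fin N)) (1 : GaugeField P j (SU N)) c : SU N) : Matrix (Fin N) (Fin N) ℂ))‖ ≤ 60 * ((((P.d + 2) * P.L : ℕ) : ℝ) * κ) := by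
  set x : ℝ := (((P.d + 2) * P.L : ℕ) : ℝ) * κ with hx
  set τ : ℝ := (((P.d + 2) * P.L : ℕ) : ℝ) * (Real.exp ‖A‖ - 1) with hτ
  set T₀ := (fun i : Idx P => ((walk (emb c.src) (loopWord P.L c.dir (off i.1) i.2.1 i.2.2)).map (fun s : LStep P j => if s.fwd then NormedSpace.exp (A s.bond) * ((U₀ s.bond : SU N) : Matrix (Fin N) (Fin N) ℂ) else star ((U₀ s.bond : SU N) : Matrix (Fin N) (Fin N) ℂ) * NormedSpace.exp (-(A s.bond)))).prod) with hT₀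
  set T₁ := (fun i : Idx P => ((walk (emb c.src) (loopWord P.L c.dir (off i.1) i.2.1 i.2.2)).map (fun s : LStep P j => if s.fwd then NormedSpace.exp (A s.bond) * (((1 : GaugeField P j (SU N)) s.bond : SU N) : Matrix (Fin N) (Fin N) ℂ) else star (((1 : GaugeField P j (SU N)) s.bond : SU N) : Matrix (Fin N) (Fin N) ℂ) * NormedSpace.exp (-(A s.bond)))).prod) with hT₁
  set S₀ := ((walk (emb c.src) (List.replicate P.L (c.dir, true))).map (fun s : LStep P j => if s.fwd then NormedSpace.exp (A s.bond) * ((U₀ s.bond : SU N) : Matrix (Fin N) (Fin N) ℂ) else star ((U₀ s.bond : SU N) : Matrix (Fin N) (Fin N) ℂ) * NormedSpace.exp (-(A s.bond)))).prod with hS₀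
  set S₁ := ((walk (emb c.src) (List.replicate P.L (c.dir, true))).map (fun s : LStep P j => if s.fwd then NormedSpace.exp (A s.bond) * (((1 : GaugeField P j (SU N)) s.bond : SU N) : Matrix (Fin N) (Fin N) ℂ) else star (((1 : GaugeField P j (SU N)) s.bond : SU N) : Matrix (Fin N) (Fin N) ℂ) * NormedSpace.exp (-(A s.bond)))).prod with hS₁
  set u := star ((avgFun (expMeanLogSU (n := Fin N)) U₀ c : SU N) : Matrix (Fin N) (Fin N) ℂ) with hu
  have hρ3 : ρ ≤ 1 / 3 := hρ.trans innerRadius_le_third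
  have hκ0 : 0 ≤ κ := kappa_nonneg_of_local U₀ hj c hκ
  have hx0 : 0 ≤ x := mul_nonneg (Nat.cast_nonneg _) hκ0
  have hx1 : x ≤ 1 / 300 := by linarith
  have he0 : 0 ≤ Real.exp ‖A‖ - 1 := by linarith [Real.add_one_le_exp ‖A‖, norm_nonneg A]
  have hτ0 : 0 ≤ τ := mul_nonneg (Nat.cast_nonneg _) he0
  have hτ1 : τ ≤ 1 / 300 := by linarith
  -- the three differences
  have hTd : ‖T₀ - T₁‖ ≤ 2 * x := by
    refine (pi_norm_le_iff_of_nonneg (by positivity)).2 fun i => ?_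
    rw [Pi.sub_apply]
    exact norm_holC_sub_holC_one_le_two_mul U₀ _ ((length_walk _ _).le.trans (length_loopWord_le c i)) A hρ3 hA hκ0
      fun s hs => hκ s.bond (blockOf_src_of_mem_walk hj c i s hs)
  have hSd : ‖S₀ - S₁‖ ≤ 2 * x :=
    norm_holC_sub_holC_one_le_two_mul U₀ _ (length_walk_replicate_le _ _ _) A hρ3 hA hκ0 fun s hs => hκ s.bond (blockOf_src_of_mem_axWalk hj c s hs)
  have hud : ‖u - 1‖ ≤ 26 * x := by
    rw [hu, ← star_one (R := Matrix (Fin N) (Fin N) ℂ), ← star_sub, norm_star]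
    exact norm_coe_avgFun_sub_one_le U₀ hj c hρ hκℓ hκ
  -- the sizes
  have hT1 : ‖T₁ - 1‖ ≤ 2 * τ := norm_loopTupleC_one_sub_one_le c A hρ3 hA
  have hE : ‖eml T₀ - eml T₁‖ ≤ 24 * x := by
    have h := norm_eml_add_sub_eml_le (U := T₁) (V := T₀ - T₁) (hT1.trans (by linarith)) (hTd.trans (by linarith))
    rw [add_sub_cancel] at h
    linarith
  have hE1 : ‖eml T₁‖ ≤ 1 + 24 * τ := by
    have h := norm_eml_add_sub_eml_le (ι := Idx P) (𝔸 := Matrix (Fin N) (Fin N) ℂ) (U := 1) (V := T₁ - 1) (by rw [sub_self, norm_zero]; norm_num) (hT1.trans (by linarith))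
    rw [add_sub_cancel, eml_one] at h
    calc ‖eml T₁‖ = ‖(eml T₁ - 1) + 1‖ := by rw [sub_add_cancel]
      _ ≤ ‖eml T₁ - 1‖ + ‖(1 : Matrix (Fin N) (Fin N) ℂ)‖ := norm_add_le _ _
      _ ≤ 12 * ‖T₁ - 1‖ + 1 := add_le_add h (by rw [norm_one])
      _ ≤ 1 + 24 * τ := by linarith
  have hSn : ∀ (V : GaugeField P j (SU N)), ‖((walk (emb c.src) (List.replicate P.L (c.dir, true))).map (fun s : LStep P j => if s.fwd then NormedSpace.exp (A s.bond) * ((V s.bond : SU N) : Matrix (Fin N) (Fin N) ℂ) else star ((V s.bond : SU N) : Matrix (Fin N) (Fin N) ℂ) * NormedSpace.exp (-(A s.bond)))).prod‖ ≤ 1 + 2 * τ := by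
    intro V
    have hS := (norm_axialC_sub_le V c A).trans (exp_pow_sub_one_le (norm_nonneg A) le_rfl (by linarith))
    have hS0 : ‖axialM (coeField V) c‖ ≤ 1 := norm_holM_coeField_le_one V _
    calc _ = ‖axialM (coeField V) c + (((walk (emb c.src) (List.replicate P.L (c.dir, true))).map (fun s : LStep P j => if s.fwd then NormedSpace.exp (A s.bond) * ((V s.bond : SU N) : Matrix (Fin N) (Fin N) ℂ) else star ((V s.bond : SU N) : Matrix (Fin N) (Fin N) ℂ) * NormedSpace.exp (-(A s.bond)))).prod - axialM (coeField V) c)‖ := by rw [add_sub_cancel]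
      _ ≤ _ := (norm_add_le _ _).trans (add_le_add hS0 hS)
  have hS0n : ‖S₀‖ ≤ 1 + 2 * τ := hSn U₀
  have hS1n : ‖S₁‖ ≤ 1 + 2 * τ := hSn (1 : GaugeField P j (SU N))
  have hu1 : ‖u‖ ≤ 1 := by rw [hu, norm_star]; exact norm_coe_SU_le_one _
  -- assemble
  rw [coe_avgFun_one, star_one, mul_one]
  have hsplit : eml T₀ * S₀ * u - eml T₁ * S₁ = (eml T₀ - eml T₁) * S₀ * u + eml T₁ * (S₀ - S₁) * u + eml T₁ * S₁ * (u - 1) := by noncomm_ring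
  rw [hsplit]
  have hτa : 1 + 2 * τ ≤ 151 / 150 := by linarith
  have hτb : 1 + 24 * τ ≤ 27 / 25 := by linarith
  calc _ ≤ ‖eml T₀ - eml T₁‖ * ‖S₀‖ * ‖u‖ + ‖eml T₁‖ * ‖S₀ - S₁‖ * ‖u‖ + ‖eml T₁‖ * ‖S₁‖ * ‖u - 1‖ :=
        (norm_add₃_le).trans (add_le_add (add_le_add ((norm_mul_le _ _).trans (mul_le_mul_of_nonneg_right (norm_mul_le _ _) (norm_nonneg _)))
          ((norm_mul_le _ _).trans (mul_le_mul_of_nonneg_right (norm_mul_le _ _) (norm_nonneg _))))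
          ((norm_mul_le _ _).trans (mul_le_mul_of_nonneg_right (norm_mul_le _ _) (norm_nonneg _))))
    _ ≤ 24 * x * (151 / 150) * 1 + 27 / 25 * (2 * x) * 1 + 27 / 25 * (151 / 150) * (26 * x) := by
        refine add_le_add (add_le_add ?_ ?_) ?_
        · exact mul_le_mul (mul_le_mul hE (hS0n.trans hτa) (norm_nonneg _) (by positivity)) hu1 (norm_nonneg _) (by positivity)
        · exact mul_le_mul (mul_le_mul (hE1.trans hτb) hSd (norm_nonneg _) (by positivity)) hu1 (norm_nonneg _) (by positivity)
        · exact mul_le_mul (mul_le_mul (hE1.trans hτb) (hS1n.trans hτa) (norm_nonneg _) (by positivity)) hud (norm_nonneg _) (by positivity)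
    _ ≤ 60 * x := by linarith

/-- ★★ **THE COMPLEXIFIED CHART READS AT `U₀` AND AT `1` DIFFER BY `67ℓκ` ON THE POLYDISC**: `‖Φ^{U₀}_c(A) − Φ^{1}_c(A)‖ ≤ 67·ℓ·κ` (both `G`'s within `27ℓ(e^{‖A‖} − 1) ≤ 1∕10` of `1`,
lit `norm_cplxRelAvg_sub_one_le`; the series `log` is `(1 − r)⁻¹`-Lipschitz there, lit `MatrixLogLipschitz.norm_mlog_sub_mlog_le`). [cite: Balaban1985Averaging, (21) p.21, Prop. 3 (121) p.36] -/
theorem norm_cplxChartRead_sub_cplxChartRead_one_le (hj : j + 1 ≤ P.m + P.K) (c : PBond P (j + 1)) {ρ κ : ℝ} (hρ : ρ ≤ innerRadius (specialUnitaryLogChart (Fin N)))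
    (hκℓ : 100 * ((((P.d + 2) * P.L : ℕ) : ℝ) * κ) ≤ ρ)
    (hκ : ∀ b : PBond P j, (blockOf b.src = c.src ∨ blockOf b.src = c.tgt) → ‖((U₀ b : SU N) : Matrix (Fin N) (Fin N) ℂ) - 1‖ ≤ κ)
    (A : PBond P j → Matrix (Fin N) (Fin N) ℂ) (hA : 100 * ((((P.d + 2) * P.L : ℕ) : ℝ) * (Real.exp ‖A‖ - 1)) ≤ ρ) :
    ‖mlog (eml (fun i : Idx P => ((walk (emb c.src) (loopWord P.L c.dir (off i.1) i.2.1 i.2.2)).map (fun s : LStep P j => if s.fwd then NormedSpace.exp (A s.bond) * ((U₀ s.bond : SU N) : Matrix (Fin N) (Fin N) ℂ) else star ((U₀ s.bond : SU N) : Matrix (Fin N) (Fin N) ℂ) * NormedSpace.exp (-(A s.bond)))).prod) * ((walk (emb c.src) (List.replicate P.L (c.dir, true))).map (fun s : LStep P j => if s.fwd then NormedSpace.exp (A s.bond) * ((U₀ s.bond : SU N) : Matrix (Fin N) (Fin N) ℂ) else star ((U₀ s.bond : SU N) : Matrix (Fin N) (Fin N) ℂ) * NormedSpace.exp (-(A s.bond)))).prod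 * star ((avgFun (expMeanLogSU (n := Fin N)) U₀ c : SU N) : Matrix (Fin N) (Fin N) ℂ)) -
      mlog (eml (fun i : Idx P => ((walk (emb c.src) (loopWord P.L c.dir (off i.1) i.2.1 i.2.2)).map (fun s : LStep P j => if s.fwd then NormedSpace.exp (A s.bond) * (((1 : GaugeField P j (SU N)) s.bond : SU N) : Matrix (Fin N) (Fin N) ℂ) else star (((1 : GaugeField P j (SU N)) s.bond : SU N) : Matrix (Fin N) (Fin N) ℂ) * NormedSpace.exp (-(A s.bond)))).prod) * ((walk (emb c.src) (List.replicate P.L (c.dir, true))).map (fun s : LStep P j => if s.fwd then NormedSpace.exp (A s.bond) * (((1 : GaugeField P j (SU N)) s.bond : SU N) : Matrix (Fin N) (Fin N) ℂ) else star (((1 : GaugeField P j (SU N)) s.bond : SU N) : Matrix (Fin N) (Fin N) ℂ) * NormedSpace.exp (-(A s.bond)))).prod * star ((avgFun (expMeanLogSU (n := Fin N)) (1 : GaugeField P j (SU N)) c : SU N) : Matrix (Fin N) (Fin N) ℂ))‖ ≤ 67 * ((((P.d + 2) * P.L : ℕ) : ℝ) * κ) := by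
  have hρ3 : ρ ≤ 1 / 3 := hρ.trans innerRadius_le_third
  have hx0 : 0 ≤ (((P.d + 2) * P.L : ℕ) : ℝ) * κ := mul_nonneg (Nat.cast_nonneg _) (kappa_nonneg_of_local U₀ hj c hκ)
  have hα : ∀ i, dist1 (loopHol U₀ c i) ≤ 2 * ((((P.d + 2) * P.L : ℕ) : ℝ) * κ) := dist1_loopHol_le_of_local U₀ hj c hρ3 hκℓ hκ
  have hα1 : ∀ i, dist1 (loopHol (1 : GaugeField P j (SU N)) c i) ≤ (0 : ℝ) := fun i => by rw [T3DescentFibreTower.loopHol_one, GaugeGroup.dist1_one]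
  have hG0 := (norm_cplxRelAvg_sub_one_le U₀ c hρ hα (by linarith) A hA).trans (show 27 * ((((P.d + 2) * P.L : ℕ) : ℝ) * (Real.exp ‖A‖ - 1)) ≤ 1 / 10 by linarith)
  have hG1 := (norm_cplxRelAvg_sub_one_le (1 : GaugeField P j (SU N)) c hρ hα1 (by linarith) A hA).trans (show 27 * ((((P.d + 2) * P.L : ℕ) : ℝ) * (Real.exp ‖A‖ - 1)) ≤ 1 / 10 by linarith)
  have h := MatrixLogLipschitz.norm_mlog_sub_mlog_le (r := 1 / 10) (by norm_num) hG0 hG1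
  have hD := norm_cplxRelAvg_sub_cplxRelAvg_one_le U₀ hj c hρ hκℓ hκ A hA
  refine h.trans ?_
  rw [div_le_iff₀ (by norm_num)]
  linarith

end Polydisc

/-! ## §6 ★★★ THE SECOND VARIATION IS LIPSCHITZ IN THE BACKGROUND, and (β-3)′ AT A CURVED BACKGROUND -/

section Main

variable {P : Params} {j : ℕ} {N : ℕ} [NeZero N] (U₀ : GaugeField P j (SU N))

/-- ★★★ **FILE C — THE SECOND-ORDER REMAINDER OF THE CHART READ IS LIPSCHITZ IN THE BACKGROUND.**  For `U₀` in the loop `α`-guard at every coarse bond (`4α ≤ ρ ≤` inner radius,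
`0 < ρ`), near the identity on the bonds issuing from `B(c₋) ∪ B(c₊)` (`‖U₀(b) − 1‖ ≤ κ` there, `100ℓκ ≤ ρ`; standing range), a radius `a > 0` with `100ℓ(e^a − 1) ≤ ρ` and a direction with `4‖X‖ ≤ a`:
  `‖[↑(ψ_{U₀}(X) c) − ↑((Dψ_{U₀}(0) X) c)] − [↑(ψ_1(X) c) − ↑((Dψ_1(0) X) c)]‖ ≤ 8·(67·ℓ·κ)·‖X‖²∕a²`
— Cauchy's second-order estimate (lit `B7TransferAnalyticMean.norm_sub_sub_fderiv_le_of_line`) for the DIFFERENCE `Φ^{U₀}_c − Φ^{1}_c` of the two holomorphic chart reads, bounded by `67ℓκ` on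
the polydisc (§5), read on the real slice ((β-2) `coe_chartRead_eq_cplxChartRead`, `coe_fderiv_chartRead_apply_eq`, at `U₀` and at `1`).  This is the background-curvature half
`q′·M²·κ(U₀)` of (β-3)′ (ARCHITECT RULING px17 g22 2026-08-31T19:55:50Z). [cite: Balaban1985Averaging, Prop. 3 (121)-(123) p.36, Prop. 4 (148)-(149) p.40] -/
theorem norm_chartRead_remainder_sub_flat_le (hj : j + 1 ≤ P.m + P.K) {α ρ : ℝ} (hρ0 : 0 < ρ) (hρ : ρ ≤ innerRadius (specialUnitaryLogChart (Fin N)))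
    (hα : ∀ c i, dist1 (loopHol U₀ c i) ≤ α) (hα4 : 4 * α ≤ ρ) {κ : ℝ} (hκℓ : 100 * ((((P.d + 2) * P.L : ℕ) : ℝ) * κ) ≤ ρ) (c : PBond P (j + 1))
    (hκ : ∀ b : PBond P j, (blockOf b.src = c.src ∨ blockOf b.src = c.tgt) → ‖((U₀ b : SU N) : Matrix (Fin N) (Fin N) ℂ) - 1‖ ≤ κ)
    {a : ℝ} (ha0 : 0 < a) (ha : 100 * ((((P.d + 2) * P.L : ℕ) : ℝ) * (Real.exp a - 1)) ≤ ρ) (X : PBond P j → (specialUnitaryLogChart (Fin N)).lie) (hX : 4 * ‖X‖ ≤ a) :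
    ‖((((isChartRep_specialUnitaryGroup (n := Fin N)).logChart (avgFun (expMeanLogSU (n := Fin N)) (fun b => (isChartRep_specialUnitaryGroup (n := Fin N)).expChart (X b) * U₀ b) c * (avgFun (expMeanLogSU (n := Fin N)) U₀ c)⁻¹) : (specialUnitaryLogChart (Fin N)).lie) : Matrix (Fin N) (Fin N) ℂ) -
        ((fderiv ℝ (fun (A : PBond P j → (specialUnitaryLogChart (Fin N)).lie) (c : PBond P (j + 1)) => (isChartRep_specialUnitaryGroup (n := Fin N)).logChart (avgFun (expMeanLogSU (n := Fin N)) (fun b => (isChartRep_specialUnitaryGroup (n := Fin N)).expChart (A b) * U₀ b) c * (avgFun (expMeanLogSU (n := Fin N)) U₀ c)⁻¹)) 0 X c : (specialUnitaryLogChart (Fin N)).lie) : Matrix (Fin N) (Fin N) ℂ)) -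
      ((((isChartRep_specialUnitaryGroup (n := Fin N)).logChart (avgFun (expMeanLogSU (n := Fin N)) (fun b => (isChartRep_specialUnitaryGroup (n := Fin N)).expChart (X b) * (1 : GaugeField P j (SU N)) b) c * (avgFun (expMeanLogSU (n := Fin N)) (1 : GaugeField P j (SU N)) c)⁻¹) : (specialUnitaryLogChart (Fin N)).lie) : Matrix (Fin N) (Fin N) ℂ) -
        ((fderiv ℝ (fun (A : PBond P j → (specialUnitaryLogChart (Fin N)).lie) (c : PBond P (j + 1)) => (isChartRep_specialUnitaryGroup (n := Fin N)).logChart (avgFun (expMeanLogSU (n := Fin N)) (fun b => (isChartRep_specialUnitaryGroup (n := Fin N)).expChart (A b) * (1 : GaugeField P j (SU N)) b) c * (avgFun (expMeanLogSU (n := Fin N)) (1 : GaugeField P j (SU N)) c)⁻¹)) 0 X c : (specialUnitaryLogChart (Fin N)).lie) : Matrix (Fin N) (Fin N) ℂ))‖ ≤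
      8 * (67 * ((((P.d + 2) * P.L : ℕ) : ℝ) * κ)) * ‖X‖ ^ 2 / a ^ 2 := by
  have hα0 : 0 ≤ α := (GaugeGroup.dist1_nonneg _).trans (hα c (Classical.arbitrary _))
  have hα1 : ∀ c' i, dist1 (loopHol (1 : GaugeField P j (SU N)) c' i) ≤ α := fun c' i => by
    rw [T3DescentFibreTower.loopHol_one, GaugeGroup.dist1_one]; exact hα0
  have hαδ : α < deltaSU (Fin N) := by linarith [hρ.trans (innerRadius_le_deltaSU (N := N)), deltaSU_pos (n := Fin N)]
  have hsmall₀ : Small (expMeanLogSU (n := Fin N)) U₀ c := fun i => lt_of_le_of_lt (hα c i) hαδ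
  have hsmall₁ : Small (expMeanLogSU (n := Fin N)) (1 : GaugeField P j (SU N)) c := fun i => lt_of_le_of_lt (hα1 c i) hαδ
  have hκ0 : 0 ≤ κ := kappa_nonneg_of_local U₀ hj c hκ
  have hΦd : DifferentiableOn ℂ (fun A : PBond P j → Matrix (Fin N) (Fin N) ℂ => mlog (eml (fun i : Idx P => ((walk (emb c.src) (loopWord P.L c.dir (off i.1) i.2.1 i.2.2)).map (fun s : LStep P j => if s.fwd then NormedSpace.exp (A s.bond) * ((U₀ s.bond : SU N) : Matrix (Fin N) (Fin N) ℂ) else star ((U₀ s.bond : SU N) : Matrix (Fin N) (Fin N) ℂ) * NormedSpace.exp (-(A s.bond)))).prod) * ((walk (emb c.src) (List.replicate P.L (c.dir, true))).map (fun s : LStep P j => if s.fwd then NormedSpace.exp (A s.bond) * ((U₀ s.bond : SU N) : Matrix (Fin N) (Fin N) ℂ) else star ((U₀ s.bond : SU N) : Matrix (Fin N) (Fin N) ℂ) * NormedSpace.exp (-(A s.bond)))).prod * star ((avgFun (expMeanLogSU (n := Fin N)) U₀ c : SU N) : Matrix (Fin N) (Fin N) ℂ)) -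
      mlog (eml (fun i : Idx P => ((walk (emb c.src) (loopWord P.L c.dir (off i.1) i.2.1 i.2.2)).map (fun s : LStep P j => if s.fwd then NormedSpace.exp (A s.bond) * (((1 : GaugeField P j (SU N)) s.bond : SU N) : Matrix (Fin N) (Fin N) ℂ) else star (((1 : GaugeField P j (SU N)) s.bond : SU N) : Matrix (Fin N) (Fin N) ℂ) * NormedSpace.exp (-(A s.bond)))).prod) * ((walk (emb c.src) (List.replicate P.L (c.dir, true))).map (fun s : LStep P j => if s.fwd then NormedSpace.exp (A s.bond) * (((1 : GaugeField P j (SU N)) s.bond : SU N) : Matrix (Fin N) (Fin N) ℂ) else star (((1 : GaugeField P j (SU N)) s.bond : SU N) : Matrix (Fin N) (Fin N) ℂ) * NormedSpace.exp (-(A s.bond)))).prod * star ((avgFun (expMeanLogSU (n := Fin N)) (1 : GaugeField P j (SU N)) c : SU N) : Matrix (Fin N) (Fin N) ℂ))) (ball (0 : PBond P j → Matrix (Fin N) (Fin N) ℂ) a) :=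
    (differentiableOn_cplxChartRead U₀ c hρ (hα c) hα4 ha).sub (differentiableOn_cplxChartRead (1 : GaugeField P j (SU N)) c hρ (hα1 c) hα4 ha)
  have hB : ∀ A ∈ ball (0 : PBond P j → Matrix (Fin N) (Fin N) ℂ) a, ‖mlog (eml (fun i : Idx P => ((walk (emb c.src) (loopWord P.L c.dir (off i.1) i.2.1 i.2.2)).map (fun s : LStep P j => if s.fwd then NormedSpace.exp (A s.bond) * ((U₀ s.bond : SU N) : Matrix (Fin N) (Fin N) ℂ) else star ((U₀ s.bond : SU N) : Matrix (Fin N) (Fin N) ℂ) * NormedSpace.exp (-(A s.bond)))).prod) * ((walk (emb c.src) (List.replicate P.L (c.dir, true))).map (fun s : LStep P j => if s.fwd then NormedSpace.exp (A s.bond) * ((U₀ s.bond : SU N) : Matrix (Fin N) (Fin N) ℂ) else star ((U₀ s.bond : SU N) : Matrix (Fin N) (Fin N) ℂ) * NormedSpace.exp (-(A s.bond)))).prod * star ((avgFun (expMeanLogSU (n := Fin N)) U₀ c : SU N) : Matrix (Fin N) (Fin N) ℂ)) -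
      mlog (eml (fun i : Idx P => ((walk (emb c.src) (loopWord P.L c.dir (off i.1) i.2.1 i.2.2)).map (fun s : LStep P j => if s.fwd then NormedSpace.exp (A s.bond) * (((1 : GaugeField P j (SU N)) s.bond : SU N) : Matrix (Fin N) (Fin N) ℂ) else star (((1 : GaugeField P j (SU N)) s.bond : SU N) : Matrix (Fin N) (Fin N) ℂ) * NormedSpace.exp (-(A s.bond)))).prod) * ((walk (emb c.src) (List.replicate P.L (c.dir, true))).map (fun s : LStep P j => if s.fwd then NormedSpace.exp (A s.bond) * (((1 : GaugeField P j (SU N)) s.bond : SU N) : Matrix (Fin N) (Fin N) ℂ) else star (((1 : GaugeField P j (SU N)) s.bond : SU N) : Matrix (Fin N) (Fin N) ℂ) * NormedSpace.exp (-(A s.bond)))).prod * star ((avgFun (expMeanLogSU (n := Fin N)) (1 : GaugeField P j (SU N)) c : SU N) : Matrix (Fin N) (Fin N) ℂ))‖ ≤ 67 * ((((P.d + 2) * P.L : ℕ) : ℝ) * κ) := by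
    intro A hAball
    have hAa : ‖A‖ ≤ a := (mem_ball_zero_iff.1 hAball).le
    have hmono : Real.exp ‖A‖ - 1 ≤ Real.exp a - 1 := by linarith [Real.exp_le_exp.2 hAa]
    exact norm_cplxChartRead_sub_cplxChartRead_one_le U₀ hj c hρ hκℓ hκ A (le_trans (by gcongr) ha)
  have hXh : ‖(fun b => ((X b : (specialUnitaryLogChart (Fin N)).lie) : Matrix (Fin N) (Fin N) ℂ))‖ ≤ ‖X‖ := norm_coePi_le X
  have hu : (0 : PBond P j → Matrix (Fin N) (Fin N) ℂ) ∈ ball (0 : PBond P j → Matrix (Fin N) (Fin N) ℂ) a := mem_ball_self ha0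
  have hv : 4 * ‖(fun b => ((X b : (specialUnitaryLogChart (Fin N)).lie) : Matrix (Fin N) (Fin N) ℂ))‖ ≤ a - ‖(0 : PBond P j → Matrix (Fin N) (Fin N) ℂ) - 0‖ := by
    rw [sub_self, norm_zero, sub_zero]; linarith
  have h := B7TransferAnalyticMean.norm_sub_sub_fderiv_le_of_line hΦd hB hu hv
  have hd₀ : DifferentiableAt ℂ (fun A : PBond P j → Matrix (Fin N) (Fin N) ℂ => mlog (eml (fun i : Idx P => ((walk (emb c.src) (loopWord P.L c.dir (off i.1) i.2.1 i.2.2)).map (fun s : LStep P j => if s.fwd then NormedSpace.exp (A s.bond) * ((U₀ s.bond : SU N) : Matrix (Fin N) (Fin N) ℂ) else star ((U₀ s.bond : SU N) : Matrix (Fin N) (Fin N) ℂ) * NormedSpace.exp (-(A s.bond)))).prod) * ((walk (emb c.src) (List.replicate P.L (c.dir, true))).map (fun s : LStep P j => if s.fwd then NormedSpace.exp (A s.bond) * ((U₀ s.bond : SU N) : Matrix (Fin N) (Fin N) ℂ) else star ((U₀ s.bond : SU N) : Matrix (Fin N) (Fin N) ℂ) * NormedSpace.exp (-(A s.bond)))).prod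 * star ((avgFun (expMeanLogSU (n := Fin N)) U₀ c : SU N) : Matrix (Fin N) (Fin N) ℂ))) 0 :=
    (analyticAt_cplxChartRead U₀ c hρ (hα c) hα4 0 (by rw [norm_zero, Real.exp_zero, sub_self, mul_zero, mul_zero]; exact hρ0.le)).differentiableAt
  have hd₁ : DifferentiableAt ℂ (fun A : PBond P j → Matrix (Fin N) (Fin N) ℂ => mlog (eml (fun i : Idx P => ((walk (emb c.src) (loopWord P.L c.dir (off i.1) i.2.1 i.2.2)).map (fun s : LStep P j => if s.fwd then NormedSpace.exp (A s.bond) * (((1 : GaugeField P j (SU N)) s.bond : SU N) : Matrix (Fin N) (Fin N) ℂ) else star (((1 : GaugeField P j (SU N)) s.bond : SU N) : Matrix (Fin N) (Fin N) ℂ) * NormedSpace.exp (-(A s.bond)))).prod) * ((walk (emb c.src) (List.replicate P.L (c.dir, true))).map (fun s : LStep P j => if s.fwd then NormedSpace.exp (A s.bond) * (((1 : GaugeField P j (SU N)) s.bond : SU N) : Matrix (Fin N) (Fin N) ℂ) else star (((1 : GaugeField P j (SU N)) s.bond : SU N) : Matrix (Fin N) (Fin N) ℂ) * NormedSpace.exp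 (-(A s.bond)))).prod * star ((avgFun (expMeanLogSU (n := Fin N)) (1 : GaugeField P j (SU N)) c : SU N) : Matrix (Fin N) (Fin N) ℂ))) 0 :=
    (analyticAt_cplxChartRead (1 : GaugeField P j (SU N)) c hρ (hα1 c) hα4 0 (by rw [norm_zero, Real.exp_zero, sub_self, mul_zero, mul_zero]; exact hρ0.le)).differentiableAt
  rw [fderiv_fun_sub hd₀ hd₁, sub_apply, zero_add, sub_self, norm_zero, sub_zero,
    cplxChartRead_zero U₀ c hsmall₀, cplxChartRead_zero (1 : GaugeField P j (SU N)) c hsmall₁, sub_zero, sub_zero] at h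
  -- read on the real slice
  have hXa : ‖X‖ ≤ a := by linarith [norm_nonneg X]
  have hX' : 100 * ((((P.d + 2) * P.L : ℕ) : ℝ) * (Real.exp ‖X‖ - 1)) ≤ ρ := by
    have hmono : Real.exp ‖X‖ - 1 ≤ Real.exp a - 1 := by linarith [Real.exp_le_exp.2 hXa]
    exact le_trans (by gcongr) ha
  rw [← coe_chartRead_eq_cplxChartRead U₀ c hρ (hα c) hα4 hρ0 X hX', ← coe_chartRead_eq_cplxChartRead (1 : GaugeField P j (SU N)) c hρ (hα1 c) hα4 hρ0 X hX',
    ← coe_fderiv_chartRead_apply_eq U₀ hρ hα hα4 hρ0 X c, ← coe_fderiv_chartRead_apply_eq (1 : GaugeField P j (SU N)) hρ hα1 hα4 hρ0 X c] at h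
  have hB0 : 0 ≤ 67 * ((((P.d + 2) * P.L : ℕ) : ℝ) * κ) := by positivity
  rw [sub_sub_sub_comm]
  calc _ ≤ 8 * (67 * ((((P.d + 2) * P.L : ℕ) : ℝ) * κ)) * ‖(fun b => ((X b : (specialUnitaryLogChart (Fin N)).lie) : Matrix (Fin N) (Fin N) ℂ))‖ ^ 2 / a ^ 2 := h
    _ ≤ 8 * (67 * ((((P.d + 2) * P.L : ℕ) : ℝ) * κ)) * ‖X‖ ^ 2 / a ^ 2 := by gcongr

/-- ★★★ **(β-3)′ AT A CURVED BACKGROUND — THE ORDER-2 BRICK IN OSCILLATION + BACKGROUND-CURVATURE FORM.**  Same background hypotheses; a radius `a > 0` with `100ℓ(e^a − 1) ≤ ρ`,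
direction data `A : Fin d → 𝔰𝔲(N)` with reference field `X̄ b = A b.dir`, `8‖A‖ ≤ a`, and `8‖X − X̄‖ ≤ a` (`B = 54ℓ(e^a − 1)`):
  `‖↑(ψ_{U₀}(X) c) − ↑((Dψ_{U₀}(0) X) c)‖ ≤ 8B·‖X − X̄‖²∕(a − ‖A‖)² + 32B·‖X − X̄‖·‖A‖∕a² + (ℓ‖A‖)³ + 8·(67ℓκ)·‖X‖²∕a²`
— ✓p834640 `norm_chartRead_sub_fderiv_le_flat_osc` (flat background: oscillation + cubic, NO `q·M²`) plus `norm_chartRead_remainder_sub_flat_le` (the curvature half `q′M²κ`).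
[cite: Balaban1985Averaging, Prop. 3 (121)-(125) p.36, Prop. 4 (148)-(149) p.40; Balaban1987RG1, (0.3)-(0.4) pp.252-253] -/
theorem norm_chartRead_sub_fderiv_le_curved_osc (hj : j + 1 ≤ P.m + P.K) {α ρ : ℝ} (hρ0 : 0 < ρ) (hρ : ρ ≤ innerRadius (specialUnitaryLogChart (Fin N)))
    (hα : ∀ c i, dist1 (loopHol U₀ c i) ≤ α) (hα4 : 4 * α ≤ ρ) {κ : ℝ} (hκℓ : 100 * ((((P.d + 2) * P.L : ℕ) : ℝ) * κ) ≤ ρ) (c : PBond P (j + 1))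
    (hκ : ∀ b : PBond P j, (blockOf b.src = c.src ∨ blockOf b.src = c.tgt) → ‖((U₀ b : SU N) : Matrix (Fin N) (Fin N) ℂ) - 1‖ ≤ κ)
    {a : ℝ} (ha0 : 0 < a) (ha : 100 * ((((P.d + 2) * P.L : ℕ) : ℝ) * (Real.exp a - 1)) ≤ ρ)
    (A : Fin P.d → (specialUnitaryLogChart (Fin N)).lie) (hAa : 8 * ‖A‖ ≤ a)
    (X : PBond P j → (specialUnitaryLogChart (Fin N)).lie) (hXA : 8 * ‖X - (fun b => A b.dir)‖ ≤ a) :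
    ‖(((isChartRep_specialUnitaryGroup (n := Fin N)).logChart (avgFun (expMeanLogSU (n := Fin N)) (fun b => (isChartRep_specialUnitaryGroup (n := Fin N)).expChart (X b) * U₀ b) c * (avgFun (expMeanLogSU (n := Fin N)) U₀ c)⁻¹) : (specialUnitaryLogChart (Fin N)).lie) : Matrix (Fin N) (Fin N) ℂ) -
        ((fderiv ℝ (fun (A : PBond P j → (specialUnitaryLogChart (Fin N)).lie) (c : PBond P (j + 1)) => (isChartRep_specialUnitaryGroup (n := Fin N)).logChart (avgFun (expMeanLogSU (n := Fin N)) (fun b => (isChartRep_specialUnitaryGroup (n := Fin N)).expChart (A b) * U₀ b) c * (avgFun (expMeanLogSU (n := Fin N)) U₀ c)⁻¹)) 0 X c : (specialUnitaryLogChart (Fin N)).lie) : Matrix (Fin N) (Fin N) ℂ)‖ ≤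
      8 * (54 * ((((P.d + 2) * P.L : ℕ) : ℝ) * (Real.exp a - 1))) * ‖X - (fun b => A b.dir)‖ ^ 2 / (a - ‖A‖) ^ 2 +
        32 * (54 * ((((P.d + 2) * P.L : ℕ) : ℝ) * (Real.exp a - 1))) * ‖X - (fun b => A b.dir)‖ * ‖A‖ / a ^ 2 +
        ((((P.d + 2) * P.L : ℕ) : ℝ) * ‖A‖) ^ 3 + 8 * (67 * ((((P.d + 2) * P.L : ℕ) : ℝ) * κ)) * ‖X‖ ^ 2 / a ^ 2 := by
  have hXbar : ‖(fun b : PBond P j => A b.dir)‖ ≤ ‖A‖ := (pi_norm_le_iff_of_nonneg (norm_nonneg A)).2 fun b => norm_le_pi_norm A b.dir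
  have hXsplit : ‖X‖ ≤ ‖X - (fun b => A b.dir)‖ + ‖(fun b : PBond P j => A b.dir)‖ := by
    calc ‖X‖ = ‖(X - (fun b => A b.dir)) + (fun b : PBond P j => A b.dir)‖ := by rw [sub_add_cancel]
      _ ≤ _ := norm_add_le _ _
  have hX4 : 4 * ‖X‖ ≤ a := by linarith
  have hXB : 4 * ‖X - (fun b => A b.dir)‖ + ‖(fun b : PBond P j => A b.dir)‖ ≤ a := by linarith [norm_nonneg (X - (fun b => A b.dir))]
  have hflat := FluctuationComparisonRegPrIntLS2BetaChartReadConstFlat.norm_chartRead_sub_fderiv_le_flat_osc (P := P) (j := j) hρ0 hρ ha0 ha A hAa X hXB c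
  have hdiff := norm_chartRead_remainder_sub_flat_le U₀ hj hρ0 hρ hα hα4 hκℓ c hκ ha0 ha X hX4
  have key : ∀ (u v : Matrix (Fin N) (Fin N) ℂ), u = (u - v) + v := fun u v => (sub_add_cancel u v).symm
  calc _ = ‖((((isChartRep_specialUnitaryGroup (n := Fin N)).logChart (avgFun (expMeanLogSU (n := Fin N)) (fun b => (isChartRep_specialUnitaryGroup (n := Fin N)).expChart (X b) * U₀ b) c * (avgFun (expMeanLogSU (n := Fin N)) U₀ c)⁻¹) : (specialUnitaryLogChart (Fin N)).lie) : Matrix (Fin N) (Fin N) ℂ) -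
        ((fderiv ℝ (fun (A : PBond P j → (specialUnitaryLogChart (Fin N)).lie) (c : PBond P (j + 1)) => (isChartRep_specialUnitaryGroup (n := Fin N)).logChart (avgFun (expMeanLogSU (n := Fin N)) (fun b => (isChartRep_specialUnitaryGroup (n := Fin N)).expChart (A b) * U₀ b) c * (avgFun (expMeanLogSU (n := Fin N)) U₀ c)⁻¹)) 0 X c : (specialUnitaryLogChart (Fin N)).lie) : Matrix (Fin N) (Fin N) ℂ)) -
      ((((isChartRep_specialUnitaryGroup (n := Fin N)).logChart (avgFun (expMeanLogSU (n := Fin N)) (fun b => (isChartRep_specialUnitaryGroup (n := Fin N)).expChart (X b) * (1 : GaugeField P j (SU N)) b) c * (avgFun (expMeanLogSU (n := Fin N)) (1 : GaugeField P j (SU N)) c)⁻¹) : (specialUnitaryLogChart (Fin N)).lie) : Matrix (Fin N) (Fin N) ℂ) -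
        ((fderiv ℝ (fun (A : PBond P j → (specialUnitaryLogChart (Fin N)).lie) (c : PBond P (j + 1)) => (isChartRep_specialUnitaryGroup (n := Fin N)).logChart (avgFun (expMeanLogSU (n := Fin N)) (fun b => (isChartRep_specialUnitaryGroup (n := Fin N)).expChart (A b) * (1 : GaugeField P j (SU N)) b) c * (avgFun (expMeanLogSU (n := Fin N)) (1 : GaugeField P j (SU N)) c)⁻¹)) 0 X c : (specialUnitaryLogChart (Fin N)).lie) : Matrix (Fin N) (Fin N) ℂ)) +
      ((((isChartRep_specialUnitaryGroup (n := Fin N)).logChart (avgFun (expMeanLogSU (n := Fin N)) (fun b => (isChartRep_specialUnitaryGroup (n := Fin N)).expChart (X b) * (1 : GaugeField P j (SU N)) b) c * (avgFun (expMeanLogSU (n := Fin N)) (1 : GaugeField P j (SU N)) c)⁻¹) : (specialUnitaryLogChart (Fin N)).lie) : Matrix (Fin N) (Fin N) ℂ) -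
        ((fderiv ℝ (fun (A : PBond P j → (specialUnitaryLogChart (Fin N)).lie) (c : PBond P (j + 1)) => (isChartRep_specialUnitaryGroup (n := Fin N)).logChart (avgFun (expMeanLogSU (n := Fin N)) (fun b => (isChartRep_specialUnitaryGroup (n := Fin N)).expChart (A b) * (1 : GaugeField P j (SU N)) b) c * (avgFun (expMeanLogSU (n := Fin N)) (1 : GaugeField P j (SU N)) c)⁻¹)) 0 X c : (specialUnitaryLogChart (Fin N)).lie) : Matrix (Fin N) (Fin N) ℂ))‖ := by rw [sub_add_cancel]
    _ ≤ _ := norm_add_le _ _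
    _ ≤ _ := add_le_add hdiff hflat
    _ = _ := by ring

end Main

end Summit.QuantumFields.YangMills.Theorems.FluctuationComparisonRegPrIntLS2BetaChartReadBkgLipschitz

end
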